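import Summits.AtomisticToContinuum.FouriersLaw.Theorems.PhononMeanFreePathCoherentDephasingBulkContact

/-!
# Census sketch (strategist s2, 2026-08-17) — crux `PhononMeanFreePath.CoherentDephasing` (stmt-AtomisticToContinuum-11810)

Typed versions of two census entries of `STRATEGY-CENSUS.md` (s2), each with its glue to the crux PROVED (no `sorry` outside the
two pairs of posited statements, which are `def … : Prop`, not claims):

* §A (Strengthen S⁺₅ / Decomposition D-C, the OLIVIER PAIR at chain-length level): `EventuallyAntitoneTransmission`
  (`I_{N}` non-increasing in the LENGTH beyond some `N₀`, `I_N = ∫₀^∞ r_N²`) and `SummableTransmission` (`Σ_N I_N < ∞`, "the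
  integrated mean free path is finite"); glue `coherentDephasing_of_antitone_of_summable` = Abel–Olivier–Pringsheim
  (`aₙ ≥ 0` antitone summable ⇒ `n aₙ → 0`), proved below (`tendsto_natMul_of_antitone_summable`).
* §B (Decomposition D-B, the lead c3's RATE × DEPHASING factorisation at the far bath): `farShare … N = γT²∫₀^∞ E_μ[(∂_{p_N}K_s p₀)²] ds`
  (the far bath's share of the Bakry–Émery dissipation of the forecast `K_s p₀`; `Δ_N` of LineStatus v9), `FarShareBound`
  (`N Δ_N ≤ C`: non-ballistic relaxation of the linearised perturbation) and `CoherenceRatioVanishes` (`γ∫r_N² ≤ ε Δ_N` eventually: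
  the far-bath tangent response has vanishing signal-to-noise ratio, rate-free dephasing); glue
  `coherentDephasing_of_farShare_of_coherenceRatio`, proved below (pure real analysis + the landed integrability clause).

Neither pair is filed (see the census for the specific reason each gives no leverage); this file only certifies that the entries
are statements over existing declarations and that their seams are theorems.
-/

noncomputable section

open MeasureTheory Set Filter Topology

namespace Summit.AtomisticToContinuum.FouriersLaw.Cruxes.CoherentDephasing.CensusS2

open Literature.MathematicalPhysics.KineticTheory.HeatConduction (pinnedChain PhaseSpace partialP)
open Summit.AtomisticToContinuum.FouriersLaw.Theses.PhononMeanFreePath (CoherentDephasing)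
open Summit.AtomisticToContinuum.FouriersLaw.Theorems.PhononMeanFreePath

/-! ## §A The Olivier pair -/

/-- `I_N = ∫₀^∞ r_N(t)² dt`, the coherent transmission functional of the `(N+1)`-site chain (the crux is `N · I_N → 0`). -/
def transmission (ω₂ lam β γ T : ℝ) (N : ℕ) : ℝ :=
  ∫ t in Ioi (0 : ℝ), pairCorr ω₂ lam β γ T N t ^ 2

/-- S⁺₅(i): the coherent transmission is eventually NON-INCREASING IN THE CHAIN LENGTH ("a longer absorbing medium transmits
less", Beer–Lambert monotonicity; harmonically true with equality from `N = 16` on, Disproof §7 calibration; MD: antitone from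
`N = 4` at all 81 cdisprove points). A comparison of TWO DIFFERENT dynamics (lengths `N` and `N+1`). -/
def EventuallyAntitoneTransmission : Prop :=
  ∀ ω₂ lam β γ : ℝ, 0 < ω₂ → 0 < lam → 0 < β → 0 < γ → ∀ T : ℝ, 0 < T →
    ∃ N₀ : ℕ, ∀ m n : ℕ, N₀ ≤ m → m ≤ n → transmission ω₂ lam β γ T n ≤ transmission ω₂ lam β γ T m

/-- S⁺₅(ii): the coherent transmissions are SUMMABLE over the length, `Σ_N I_N < ∞` — "the integrated thermal mean free path
`Σ_N I_N ≈ A·ℓ·T²/(2γ)` is finite"; false harmonically (`I_N → T²/16`). Under (i) it is STRONGER than the crux. -/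
def SummableTransmission : Prop :=
  ∀ ω₂ lam β γ : ℝ, 0 < ω₂ → 0 < lam → 0 < β → 0 < γ → ∀ T : ℝ, 0 < T →
    Summable (fun N : ℕ => transmission ω₂ lam β γ T N)

/-- **Abel–Olivier–Pringsheim.** A non-negative, eventually non-increasing, summable real sequence satisfies `n · aₙ → 0`.
[folklore] -/
theorem tendsto_natMul_of_antitone_summable {a : ℕ → ℝ} (h0 : ∀ n, 0 ≤ a n)
    (hanti : ∃ N₀ : ℕ, ∀ m n : ℕ, N₀ ≤ m → m ≤ n → a n ≤ a m) (hsum : Summable a) :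
    Tendsto (fun n : ℕ => (n : ℝ) * a n) atTop (𝓝 0) := by
  obtain ⟨N₀, hanti⟩ := hanti
  rw [Metric.tendsto_atTop]
  intro ε hε
  -- Cauchy criterion: sums over finite sets avoiding a fixed finite set `s` have norm `< ε/2`
  obtain ⟨s, hs⟩ := summable_iff_vanishing_norm.1 hsum (ε / 2) (half_pos hε)
  -- a bound `M` above every element of `s`
  set M : ℕ := s.sup id + 1 with hM
  have hsM : ∀ k ∈ s, k < M := fun k hk => Nat.lt_succ_of_le (Finset.le_sup (f := id) hk)
  refine ⟨2 * M + 2 * N₀ + 2, fun n hn => ?_⟩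
  rw [Real.dist_eq, sub_zero]
  -- the block `t = (n/2, n]`
  set t : Finset ℕ := Finset.Ico (n / 2 + 1) (n + 1) with ht
  have htdisj : Disjoint t s := by
    rw [Finset.disjoint_left]
    intro k hk hks
    have hk1 : n / 2 + 1 ≤ k := (Finset.mem_Ico.1 hk).1
    have := hsM k hks
    omega
  have hsum_t : |∑ k ∈ t, a k| < ε / 2 := by
    have := hs t htdisj
    simpa [Real.norm_eq_abs] using this
  have hcard : (t.card : ℝ) = (n : ℝ) - ((n / 2 : ℕ) : ℝ) := by
    have h1 : t.card = n - n / 2 := by rw [ht, Nat.card_Ico]; omega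
    rw [h1, Nat.cast_sub (Nat.div_le_self n 2)]
  -- each term of the block dominates `a n`
  have hterm : ∀ k ∈ t, a n ≤ a k := by
    intro k hk
    obtain ⟨hk1, hk2⟩ := Finset.mem_Ico.1 hk
    exact hanti k n (by omega) (by omega)
  have hblock : (t.card : ℝ) * a n ≤ ∑ k ∈ t, a k := by
    have := Finset.card_nsmul_le_sum t a (a n) hterm
    simpa [nsmul_eq_mul] using this
  have hhalf : (n : ℝ) ≤ 2 * (t.card : ℝ) := by
    rw [hcard]
    have h2 : 2 * ((n / 2 : ℕ) : ℝ) ≤ (n : ℝ) := by exact_mod_cast Nat.mul_div_le n 2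
    linarith
  have han : 0 ≤ a n := h0 n
  calc |(n : ℝ) * a n| = (n : ℝ) * a n := abs_of_nonneg (mul_nonneg (Nat.cast_nonneg n) han)
    _ ≤ 2 * (t.card : ℝ) * a n := by nlinarith
    _ ≤ 2 * ∑ k ∈ t, a k := by nlinarith
    _ ≤ 2 * |∑ k ∈ t, a k| := by
        have := le_abs_self (∑ k ∈ t, a k); linarith
    _ < ε := by linarith

/-- **Glue of the Olivier pair**: (i) ∧ (ii) ⇒ the crux (by name); integrability clause from the tree. [folklore] -/
theorem coherentDephasing_of_antitone_of_summable
    (hA : EventuallyAntitoneTransmission) (hS : SummableTransmission) : CoherentDephasing := by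
  intro ω₂ lam β γ hω hl hβ hγ T hT
  refine ⟨fun N => Summit.AtomisticToContinuum.FouriersLaw.Theorems.CoherentDephasing.pairCorr_sq_integrableOn
    hω hl.le hβ hγ hT N, ?_⟩
  have h := tendsto_natMul_of_antitone_summable (a := fun N => transmission ω₂ lam β γ T N)
    (fun N => setIntegral_nonneg measurableSet_Ioi fun t _ => sq_nonneg _)
    (hA ω₂ lam β γ hω hl hβ hγ T hT) (hS ω₂ lam β γ hω hl hβ hγ T hT)
  simpa [transmission, pairCorr, fcast] using h

/-! ## §B Rate × dephasing at the far bath (lead c3's factorisation, typed) -/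

/-- `Δ_N := γ T² ∫₀^∞ ∫ (∂_{p_N} (K_s p₀)(z))² dμ_T(z) ds` — the FAR bath's share of the Bakry–Émery dissipation of the forecast
`K_s p₀ : z ↦ E_z[p₀(s)]` (`Δ_0 + Δ_N ≤ T²/2`, landed forecast budget); `γ∫₀^∞ r_N² = ρ_N · Δ_N` with the coherence ratio
`ρ_N = ∫(E_μ X_s)² ds / ∫E_μ[X_s²] ds ∈ [0,1]`, `X_s = ∂_{p_N}K_s p₀` (Gaussian integration by parts in `p_N` + Jensen). -/
def farShare (ω₂ lam β γ T : ℝ) (N : ℕ) : ℝ :=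
  γ * T ^ 2 * ∫ s in Ioi (0 : ℝ), ∫ z,
    (partialP (Fin.last N)
      (fun w : PhaseSpace (N + 1) => ∫ y, y.2 0 ∂((pinnedChain ω₂ lam β γ).transitionKernel (N + 1) T T s.toNNReal w)) z) ^ 2
    ∂((pinnedChain ω₂ lam β γ).gibbsMeasure (N + 1) T)

/-- D-B(i) RATE WITHOUT DEPHASING: the far bath's share of the forecast dissipation is `O(1/N)` ("non-ballistic relaxation of
the linearised perturbation": diffusively a walker from site `0` exits at `N` with probability `~ℓ/N`; harmonically the share
tends to a positive constant, so this is false at `lam = β = 0`). Transport (bounded-response) depth. -/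
def FarShareBound : Prop :=
  ∀ ω₂ lam β γ : ℝ, 0 < ω₂ → 0 < lam → 0 < β → 0 < γ → ∀ T : ℝ, 0 < T →
    ∃ C : ℝ, ∀ N : ℕ, (N : ℝ) * farShare ω₂ lam β γ T N ≤ C

/-- D-B(ii) DEPHASING WITHOUT RATE: the coherence ratio of the far-bath tangent response vanishes,
`γ∫₀^∞ r_N² ≤ ε · Δ_N` eventually in `N` for every `ε > 0` (harmonically `X_s` is deterministic and the ratio is `1`). -/
def CoherenceRatioVanishes : Prop :=
  ∀ ω₂ lam β γ : ℝ, 0 < ω₂ → 0 < lam → 0 < β → 0 < γ → ∀ T : ℝ, 0 < T →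
    ∀ ε : ℝ, 0 < ε → ∃ N₀ : ℕ, ∀ N : ℕ, N₀ ≤ N →
      γ * ∫ t in Ioi (0 : ℝ), pairCorr ω₂ lam β γ T N t ^ 2 ≤ ε * farShare ω₂ lam β γ T N

/-- `Δ_N ≥ 0` (integral of a square, junk value included). [folklore] -/
theorem farShare_nonneg {ω₂ lam β γ T : ℝ} (hγ : 0 ≤ γ) (N : ℕ) : 0 ≤ farShare ω₂ lam β γ T N := by
  unfold farShare
  refine mul_nonneg (mul_nonneg hγ (sq_nonneg T)) ?_
  exact setIntegral_nonneg measurableSet_Ioi fun s _ => integral_nonneg fun z => sq_nonneg _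

/-- **Glue of the far-bath factorisation**: `FarShareBound ∧ CoherenceRatioVanishes ⇒ CoherentDephasing` (by name):
`N γ ∫r_N² ≤ ε N Δ_N ≤ ε C`. [folklore] -/
theorem coherentDephasing_of_farShare_of_coherenceRatio
    (hF : FarShareBound) (hR : CoherenceRatioVanishes) : CoherentDephasing := by
  intro ω₂ lam β γ hω hl hβ hγ T hT
  refine ⟨fun N => Summit.AtomisticToContinuum.FouriersLaw.Theorems.CoherentDephasing.pairCorr_sq_integrableOn
    hω hl.le hβ hγ hT N, ?_⟩
  obtain ⟨C, hC⟩ := hF ω₂ lam β γ hω hl hβ hγ T hT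
  have hRT := hR ω₂ lam β γ hω hl hβ hγ T hT
  -- abbreviations
  set I : ℕ → ℝ := fun N => ∫ t in Ioi (0 : ℝ), pairCorr ω₂ lam β γ T N t ^ 2 with hI
  set Δ : ℕ → ℝ := fun N => farShare ω₂ lam β γ T N with hΔ
  have hI0 : ∀ N, 0 ≤ I N := fun N => setIntegral_nonneg measurableSet_Ioi fun t _ => sq_nonneg _
  have hΔ0 : ∀ N, 0 ≤ Δ N := fun N => farShare_nonneg hγ.le N
  have hC0 : 0 ≤ C := le_trans (mul_nonneg (Nat.cast_nonneg 0) (hΔ0 0)) (hC 0)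
  change Tendsto (fun N : ℕ => (N : ℝ) * I N) atTop (𝓝 0)
  rw [Metric.tendsto_atTop]
  intro ε hε
  -- choose the dephasing tolerance `ε' = γ ε / (2 (C + 1))`
  obtain ⟨N₀, hN₀⟩ := hRT (γ * ε / (2 * (C + 1))) (by positivity)
  refine ⟨N₀, fun N hN => ?_⟩
  rw [Real.dist_eq, sub_zero, abs_of_nonneg (mul_nonneg (Nat.cast_nonneg N) (hI0 N))]
  have h1 : γ * I N ≤ γ * ε / (2 * (C + 1)) * Δ N := hN₀ N hN
  have h2 : (N : ℝ) * Δ N ≤ C := hC N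
  have hN0 : (0 : ℝ) ≤ N := Nat.cast_nonneg N
  -- `γ N I_N ≤ ε' N Δ_N ≤ ε' C < γ ε`
  have h3 : γ * ((N : ℝ) * I N) ≤ γ * ε / (2 * (C + 1)) * C := by
    calc γ * ((N : ℝ) * I N) = (N : ℝ) * (γ * I N) := by ring
      _ ≤ (N : ℝ) * (γ * ε / (2 * (C + 1)) * Δ N) := mul_le_mul_of_nonneg_left h1 hN0
      _ = γ * ε / (2 * (C + 1)) * ((N : ℝ) * Δ N) := by ring
      _ ≤ γ * ε / (2 * (C + 1)) * C := mul_le_mul_of_nonneg_left h2 (by positivity)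
  have h4 : γ * ε / (2 * (C + 1)) * C < γ * ε := by
    have hC1 : C / (C + 1) < 1 := by rw [div_lt_one (by positivity)]; linarith
    have : γ * ε / (2 * (C + 1)) * C = γ * ε * (C / (C + 1)) / 2 := by field_simp
    rw [this]
    have hγε : 0 < γ * ε := by positivity
    nlinarith
  have h5 : γ * ((N : ℝ) * I N) < γ * ε := lt_of_le_of_lt h3 h4
  exact lt_of_mul_lt_mul_left h5 hγ.le

end Summit.AtomisticToContinuum.FouriersLaw.Cruxes.CoherentDephasing.CensusS2

end
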